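import Literature.NumberTheory.GaloisCohomology.RestrictedRamificationFiniteCohomologyOfH2Mu
import Literature.NumberTheory.GaloisCohomology.RestrictedRamificationH2MuFinite
import HarnessLib

/-!
# Harari Cor. 17.17 / Milne ADT I Cor. 4.15 / NSW (8.3.20) at TOTALLY COMPLEX number fields:
# the named fact `finite_restrictedCohomology K` DISCHARGED

Topic `NumberTheory/GaloisCohomology`; namespace `Literature.NumberTheory.GaloisCohomology`.  THEOREMS ONLY (no
definition, no named fact, no `sorry`, no instance; D-0026).  Lane «TATE-EPC-TC» of cell `bsd-eis` (crux
`GoodLatticeBDPValue`, stmt-BirchSwinnertonDyer-19032), brick (B1c) = the CLOSER: -w3 g15's reduction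
`finite_restrictedCohomology_of_isTotallyComplex_of_forall_H2_mu` (`RestrictedRamificationFiniteCohomologyOfH2Mu`:
`r = 0` trivial, `r = 1` Hermite, `r = 2` -w7 g9's dévissage `finite_restrictedCohomology_two_of_forall_H2_mu'` from
(H2μ-fin), `r ≥ 3` from `cd_p G_{K,S} ≤ 2` = lane «PT3-TC») fed with (H2μ-fin) = (B1a)
`finite_continuousCohomology_two_mu_of_isTotallyComplex` (`RestrictedRamificationH2MuFinite`: Kummer on the `S`-units,
`H¹(U, E_S)` finite and `H²(U, E_S)[p]` finite, NSW (8.3.11)).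

* **`finite_restrictedCohomology_of_isTotallyComplex (K) [IsTotallyComplex K] : finite_restrictedCohomology K`** — for
  `S` finite and `M` a finite discrete `Γ_K`-module unramified outside `S` with every place dividing `#M` in `S`,
  `Hʳ(G_S, M)` is finite for every `r`; `forall_finite_restrictedCohomology_of_isTotallyComplex` is the `∀ K`-closed form.

HONEST FRAMING: a textbook theorem proved at totally complex fields by assembling the lane's bricks (seats -w2 g8/g9,
-w3 g14/g15, -w4 g16/g17, -w5 g6/g7, -w6 g8/g9, -w7 g8/g9, -w8 g9/g10 of line `x1-p1`); fields with a real place are NOT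
covered (there `cd_p G_{K,S} ≤ 2` needs `p ≠ 2` and the archimedean invariants enter (F2b)); no statement of a Summit,
not Tate's Euler-characteristic formula, not the crux is proved here; 0 cells / labels / tiers move.

## References
* D. Harari, *Galois Cohomology and Class Field Theory* (2020), Cor. 17.17 (p. 295). [Harari2020]
* J. S. Milne, *Arithmetic Duality Theorems*, 2nd ed. (2006), I §4 Cor. 4.15 (p. 61). [MilneADT2006]
* J. Neukirch, A. Schmidt, K. Wingberg, *Cohomology of Number Fields*, 2nd ed. (2008), (8.3.20). [NeukirchSchmidtWingberg2008]
-/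

noncomputable section

open CategoryTheory Function NumberField Field IsDedekindDomain Topology
open scoped NumberField

namespace Literature.NumberTheory.GaloisCohomology

open Literature.NumberTheory.GaloisRepresentations

variable {K : Type} [Field K] [NumberField K]

/-- **HARARI COR. 17.17 / MILNE I COR. 4.15 / NSW (8.3.20) AT A TOTALLY COMPLEX NUMBER FIELD**: the named fact
`finite_restrictedCohomology K` — for `S` finite, `M` a finite discrete `Γ_K`-module unramified outside `S` with every
place dividing `#M` in `S`, `Hʳ(G_S, M)` is finite for every `r` — HOLDS.  ((B1a) `finite_continuousCohomology_two_mu_of_isTotallyComplex` fed to the reduction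
`finite_restrictedCohomology_of_isTotallyComplex_of_forall_H2_mu`: `r = 0` trivial, `r = 1` Hermite, `r = 2` dévissage +
Kummer on the `S`-units, `r ≥ 3` from `cd_p G_{K,S} ≤ 2`.) [cite: Harari2020, Cor. 17.17] [cite: MilneADT2006, I §4 Cor. 4.15]
[cite: NeukirchSchmidtWingberg2008, (8.3.20)] -/
theorem finite_restrictedCohomology_of_isTotallyComplex [IsTotallyComplex K] : finite_restrictedCohomology K :=
  finite_restrictedCohomology_of_isTotallyComplex_of_forall_H2_mu fun S hS p _ hSp ρ₀ hρ₀ U hU hfix =>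
    finite_continuousCohomology_two_mu_of_isTotallyComplex S hS p hSp ρ₀ hρ₀ U hU hfix

/-- `∀`-closed form: **Harari Cor. 17.17 holds at every totally complex number field.** [cite: Harari2020, Cor. 17.17]
[cite: MilneADT2006, I §4 Cor. 4.15] -/
theorem forall_finite_restrictedCohomology_of_isTotallyComplex :
    ∀ (L : Type) [Field L] [NumberField L] [IsTotallyComplex L], finite_restrictedCohomology L :=
  fun L _ _ _ => finite_restrictedCohomology_of_isTotallyComplex (K := L)

end Literature.NumberTheory.GaloisCohomology

end
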